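import Summits.QuantumFields.YangMills.Theorems.BalabanUVNodesPortZDStepRows

/-!
# NODE O port, row PT-A′ helper lane (PTZ-1): the (1.19) ∕ (2.16) rows of the zero-input layer IN THEIR PRINTED, ON-DOMAIN FORM —
# `R_k(A)(W^v) = R_k(A)(W)` for `W` in the small-field domain of the step, the bound action `A` invariant ON the level-k domain only,
# the transport's image invariant ON the level-(k+1) domain only (the shape `B12ContinuousTransportInvarianceOn` delivers for `A_k`)

[Balaban1987RG1] = [I] (CMP 109, 1987): p. 263 («the action A_k(U) defined on the space U_k(ε₀), which is contained in all the spaces U^c_j(X, α₀, α₁), is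
gauge invariant»), (2.16) p. 269, (0.13) p. 254, (0.19) p. 255, (0.21) p. 256, (1.2) p. 260; [Balaban1985Variational] = [15]: Thm 1 p. 279, (181) p. 307.

Seat `ymgap-nodeO-port-PTZ-1` g0 (prover, HELPER MODE; every file `--supports stmt-QuantumFields-27930 --as helper`; nothing keyed to 26648).  Companion of
`BalabanUVNodesPortZDStepRows` §3 (this seat, ✓p797663): there `stepOutT_gaugeAct` asks the GLOBAL mapping property of `T K k` and GLOBAL `GaugeInvariant A`; print
states (1.19) ON THE DOMAINS, and the tree's N09 MODULE 5 `B12ContinuousTransportInvarianceOn` delivers exactly the on-domain shapes (`invOn_effActionHT_of_stepsOn`: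
`A_k(V^v) = A_k(V)` for `V ∈ D_k`; `stepInvOn_of_isRT_continuousOn`: the image `T K j ρ_j` invariant on `D_{j+1}` for a transport continuous on the domain only —
the case of the canonical-version transport of record).  This module re-cuts §3 in that currency (MODULE 5 is cited for the shapes, not imported), every set `D`, `D'` a bookkeeping VARIABLE (χ, T, A BOUND;
selection-FREE per CRIT-1 Q-5 (β)); the ONE extra binder is the located NESTING `Ū^k(U_{k+1}W) ∈ D` ([I] (1.2) p. 260 ∕ [B11] Thm 1: the averaged regular
minimiser is small-field — the same binder MODULE 5's `hCompT_of_hOrbit_of_invOn` carries).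

WHAT IS PROVED (0 sorry, 0 def): `nextAction_gaugeAct_on` (one step of (0.19) on the domain, generic input `A`: `𝐓_k(A)(V^v) = 𝐓_k(A)(V)` for `V ∈ D'` whenever
the image `T K k (χ_k e^{−GF∕g² + A})` is invariant on `D'`); `apply_iter_Uk_gaugeAct_on` (a level-k functional invariant ON a gauge-stable set `D` under all level-k
gauge transformations reads the same value at `Ū^k U_{k+1}(W^v)` and `Ū^k U_{k+1}(W)` when the latter lies in `D`; [B11] clauses as in §3);
`stepOutT_gaugeAct_on` (both together: `R_k(A)(W^v) = R_k(A)(W)`); `zeroInputMergedTermT_gaugeAct_on` (𝓝⁰: `A⁰_k` is globally invariant, so only the image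
clause and the [B11] clauses remain); `mergedTermT_gaugeAct_on` ∕ `dChannel_gaugeAct_on` (𝓝 and 𝓓 := 𝓝 − 𝓝⁰ with `A_k`'s on-domain invariance DISPLAYED in
MODULE 5's output shape).

HONEST FRAMING.  Kernel bookkeeping; the on-domain image property, the on-domain invariance of `A_k`, the nesting and the [B11] clauses are HYPOTHESES displayed by
name; nothing of Bałaban's estimates asserted, ported or discharged; 26648 UNSIGNED, 27930⁷ ∕ 27931⁷ OPEN; K0⁷ ∕ stub 2′ OPEN; counts unmoved; finite 𝕋⁴ at fixed
ε — NOT continuum ∕ OS ∕ Clay; the Yang–Mills mass gap is NOT proved by any of this.  No `sorry`, no `instance`, no `notation`, no `def`.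
-/

noncomputable section

namespace Summit.QuantumFields.YangMills.Theorems.PortZD

open Literature.MathematicalPhysics.QuantumFieldTheory.Balaban1983to89
open Literature.MathematicalPhysics.QuantumFieldTheory.Balaban1983to89.Node00
open Literature.MathematicalPhysics.QuantumFieldTheory.Balaban1983to89.Node00.ZeroInput
open T4Continuum (T4Family)
open B12Eq019ActionBody (nextAction nextAction_apply integrand)
open B12GaugeOrbits021 (OrbitRel)
open B15Eq177GaugeInvariance (blockLift)
open B16Sect1Backgrounds (toMS iter_gaugeAct)
open GaugeField (gaugeAct GaugeInvariant)

/-- **ONE STEP OF (0.19) ON THE DOMAIN, GENERIC INPUT**: if the image `T(χ e^{−GF∕g² + A})` is invariant at every point of `D'`, so is `𝐓(A) = log 𝐍⁻¹ T(…)`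
(`𝐍` does not see `V`; MODULE 5's `invOn_effActionHT_succ_of_stepOn` is the instance `A := A_j`). [cite: Balaban1987RG1, (0.19) p.255 and p.263] -/
theorem nextAction_gaugeAct_on {P : Params} {G : Type*} [GaugeGroup G] {k : ℕ} {T : Density P k G → Density P (k + 1) G}
    {χ GF A : Density P k G} {gk : ℝ} {D' : Set (GaugeField P (k + 1) G)}
    (hTon : ∀ (v : GaugeTransf P (k + 1) G) (V : GaugeField P (k + 1) G), V ∈ D' →
      T (integrand χ GF gk A) (gaugeAct v V) = T (integrand χ GF gk A) V)
    (v : GaugeTransf P (k + 1) G) {V : GaugeField P (k + 1) G} (hV : V ∈ D') :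
    nextAction T χ GF gk A (gaugeAct v V) = nextAction T χ GF gk A V := by
  rw [nextAction_apply, nextAction_apply, hTon v V hV]

variable {F : T4Family} {N : ℕ} [NeZero N]

/-- **A LEVEL-k FUNCTIONAL INVARIANT ON A GAUGE-STABLE SET `D` READS THE SAME VALUE AT `Ū^k U_{k+1}(W^v)` AND `Ū^k U_{k+1}(W)`**, provided the latter lies in `D`
(the NESTING binder «the averaged regular minimiser is small-field», [I] (1.2) ∕ [B11] Thm 1), `k + 1 ≤ m + K`, `UkExists (k+1) W`, `UniqueUkOrbit (k+1) (W^v)`: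
`U_{k+1}(W^v) = ((U_{k+1}W)^{v̄})^{u}` with `u` residual (`PortZD.orbitRel_Uk_gaugeAct_blockLift`), the k-fold average intertwines both transformations with their
restrictions to `T⁽ᵏ⁾` (`iter_gaugeAct`), and `A` is invariant at the two points of `D` so reached. [cite: Balaban1987RG1, (0.21) p.256, (1.2) p.260, (2.16) p.269; Balaban1985Variational, (181) p.307] -/
theorem apply_iter_Uk_gaugeAct_on {K k : ℕ} (hk : k + 1 ≤ (F.P K).m + (F.P K).K) {ε : ℝ} {A : Density (F.P K) k (SU N)}
    {D : Set (GaugeField (F.P K) k (SU N))}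
    (hDst : ∀ (w : GaugeTransf (F.P K) k (SU N)) (U : GaugeField (F.P K) k (SU N)), U ∈ D → gaugeAct w U ∈ D)
    (hAon : ∀ (w : GaugeTransf (F.P K) k (SU N)) (U : GaugeField (F.P K) k (SU N)), U ∈ D → A (gaugeAct w U) = A U)
    (v : GaugeTransf (F.P K) (k + 1) (SU N)) {W : GaugeField (F.P K) (k + 1) (SU N)}
    (hnest : Averaging.iter (avOfRecord F N K) k (Uk F N K (k + 1) ε W) ∈ D)
    (hW : UkExists F N K (k + 1) ε W) (hu : UniqueUkOrbit F N K (k + 1) ε (gaugeAct v W)) :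
    A (Averaging.iter (avOfRecord F N K) k (Uk F N K (k + 1) ε (gaugeAct v W))) =
      A (Averaging.iter (avOfRecord F N K) k (Uk F N K (k + 1) ε W)) := by
  obtain ⟨u, -, hEq⟩ := orbitRel_Uk_gaugeAct_blockLift hk v hW hu
  have hk' : k ≤ (F.P K).m + (F.P K).K := Nat.le_of_succ_le hk
  rw [hEq, iter_gaugeAct (avOfRecord F N K) u _ k hk', iter_gaugeAct (avOfRecord F N K) (blockLift (k + 1) v) _ k hk',
    hAon _ _ (hDst _ _ hnest), hAon _ _ hnest]

variable (F N)

/-- **(1.19) ∕ (2.16) FOR THE STEP FUNCTIONAL, ON THE DOMAINS**: `R_k(A)(W^v) = R_k(A)(W)` for `W ∈ D'` from: the image `T K k (χ_k e^{−GF_k∕g_k² + A})` invariant ON `D'`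
(MODULE 5 `stepInvOn_of_isRT_continuousOn`: an integrable `IsRT` image continuous on an open gauge-stable `D'`, of a lift-invariant density — itself supplied by
`liftInvariant_integrand_of_invOn` from `A` invariant on `D ⊇ supp χ_k`), `A` invariant ON the gauge-stable level-k set `D` under all level-k transformations, the
nesting `Ū^k U_{k+1}(W) ∈ D`, `k + 1 ≤ m + K`, `UkExists (k+1) W`, `UniqueUkOrbit (k+1) (W^v)`. [cite: Balaban1987RG1, (1.19) p.263, (2.16) p.269, (0.13) p.254] -/
theorem stepOutT_gaugeAct_on (T : Transport F N) (χ : (K : ℕ) → (ℕ → ℝ) → (k : ℕ) → Density (F.P K) k (SU N)) (ε : ℝ) {K : ℕ} (g : ℕ → ℝ)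
    {k : ℕ} (hk : k + 1 ≤ (F.P K).m + (F.P K).K) {A : Density (F.P K) k (SU N)} {D : Set (GaugeField (F.P K) k (SU N))}
    {D' : Set (GaugeField (F.P K) (k + 1) (SU N))}
    (hTon : ∀ (v : GaugeTransf (F.P K) (k + 1) (SU N)) (V : GaugeField (F.P K) (k + 1) (SU N)), V ∈ D' →
      T K k (integrand (χ K g k) (gfOfRecord F N K k) (g k) A) (gaugeAct v V) = T K k (integrand (χ K g k) (gfOfRecord F N K k) (g k) A) V)
    (hDst : ∀ (w : GaugeTransf (F.P K) k (SU N)) (U : GaugeField (F.P K) k (SU N)), U ∈ D → gaugeAct w U ∈ D)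
    (hAon : ∀ (w : GaugeTransf (F.P K) k (SU N)) (U : GaugeField (F.P K) k (SU N)), U ∈ D → A (gaugeAct w U) = A U)
    (v : GaugeTransf (F.P K) (k + 1) (SU N)) {W : GaugeField (F.P K) (k + 1) (SU N)} (hWD : W ∈ D')
    (hnest : Averaging.iter (avOfRecord F N K) k (Uk F N K (k + 1) ε W) ∈ D)
    (hW : UkExists F N K (k + 1) ε W) (hu : UniqueUkOrbit F N K (k + 1) ε (gaugeAct v W)) :
    stepOutT F N T χ ε K g k A (gaugeAct v W) = stepOutT F N T χ ε K g k A W := by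
  rw [stepOutT, stepOutT, nextAction_gaugeAct_on hTon v hWD, apply_iter_Uk_gaugeAct_on hk hDst hAon v hnest hW hu]

/-- **THE (1.19) ROW OF (Z) ON THE DOMAIN**: `𝓝⁰_{k+1}(W^v) = 𝓝⁰_{k+1}(W)` for `W ∈ D'` — `A⁰_k` is gauge invariant EVERYWHERE (`PortZD.gaugeInvariant_mainTermT`), so only
the image clause (for the zero-input density `χ_k e^{−GF_k∕g_k² + A⁰_k}`) and the [B11] clauses remain; no nesting binder. [cite: Balaban1987RG1, (1.19) p.263, (2.16) p.269] -/
theorem zeroInputMergedTermT_gaugeAct_on (T : Transport F N) (χ : (K : ℕ) → (ℕ → ℝ) → (k : ℕ) → Density (F.P K) k (SU N)) (ε : ℝ)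
    {K : ℕ} (g : ℕ → ℝ) {k : ℕ} (hk : k + 1 ≤ (F.P K).m + (F.P K).K) {D' : Set (GaugeField (F.P K) (k + 1) (SU N))}
    (hTon : ∀ (v : GaugeTransf (F.P K) (k + 1) (SU N)) (V : GaugeField (F.P K) (k + 1) (SU N)), V ∈ D' →
      T K k (integrand (χ K g k) (gfOfRecord F N K k) (g k) (mainTermT F N ε K g k)) (gaugeAct v V) =
        T K k (integrand (χ K g k) (gfOfRecord F N K k) (g k) (mainTermT F N ε K g k)) V)
    (v : GaugeTransf (F.P K) (k + 1) (SU N)) {W : GaugeField (F.P K) (k + 1) (SU N)} (hWD : W ∈ D')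
    (hW : UkExists F N K (k + 1) ε W) (hu : UniqueUkOrbit F N K (k + 1) ε (gaugeAct v W)) :
    zeroInputMergedTermT F N T χ ε K g k (gaugeAct v W) = zeroInputMergedTermT F N T χ ε K g k W := by
  rw [zeroInputMergedTermT_eq_stepOut, zeroInputMergedTermT_eq_stepOut]
  exact stepOutT_gaugeAct_on F N T χ ε g hk (D := Set.univ) hTon (fun _ _ _ => Set.mem_univ _)
    (fun w U _ => gaugeInvariant_mainTermT F N ε g (Nat.le_of_succ_le hk) w U) v hWD (Set.mem_univ _) hW hu

/-- **THE MERGED TERM ON THE DOMAIN**: `𝓝_{k+1}(W^v) = 𝓝_{k+1}(W)` for `W ∈ D'`, with `A_k` invariant ON the gauge-stable level-k domain `D` (DISPLAYED in the shape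
MODULE 5's `invOn_effActionHT_of_stepsOn` delivers over a transport continuous on the domains), the image of the level-k density invariant on `D'`, and the nesting
`Ū^k U_{k+1}(W) ∈ D`. [cite: Balaban1987RG1, p.263, (2.16) p.269] -/
theorem mergedTermT_gaugeAct_on (T : Transport F N) (χ : (K : ℕ) → (ℕ → ℝ) → (k : ℕ) → Density (F.P K) k (SU N)) (ε : ℝ) {K : ℕ}
    (g : ℕ → ℝ) {k : ℕ} (hk : k + 1 ≤ (F.P K).m + (F.P K).K) {D : Set (GaugeField (F.P K) k (SU N))}
    {D' : Set (GaugeField (F.P K) (k + 1) (SU N))}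
    (hTon : ∀ (v : GaugeTransf (F.P K) (k + 1) (SU N)) (V : GaugeField (F.P K) (k + 1) (SU N)), V ∈ D' →
      T K k (integrand (χ K g k) (gfOfRecord F N K k) (g k) (effActionHT F N T χ K g k)) (gaugeAct v V) =
        T K k (integrand (χ K g k) (gfOfRecord F N K k) (g k) (effActionHT F N T χ K g k)) V)
    (hDst : ∀ (w : GaugeTransf (F.P K) k (SU N)) (U : GaugeField (F.P K) k (SU N)), U ∈ D → gaugeAct w U ∈ D)
    (hAon : ∀ (w : GaugeTransf (F.P K) k (SU N)) (U : GaugeField (F.P K) k (SU N)), U ∈ D →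
      effActionHT F N T χ K g k (gaugeAct w U) = effActionHT F N T χ K g k U)
    (v : GaugeTransf (F.P K) (k + 1) (SU N)) {W : GaugeField (F.P K) (k + 1) (SU N)} (hWD : W ∈ D')
    (hnest : Averaging.iter (avOfRecord F N K) k (Uk F N K (k + 1) ε W) ∈ D)
    (hW : UkExists F N K (k + 1) ε W) (hu : UniqueUkOrbit F N K (k + 1) ε (gaugeAct v W)) :
    mergedTermT F N T χ ε K g k (gaugeAct v W) = mergedTermT F N T χ ε K g k W := by
  rw [mergedTermT_eq_stepOut, mergedTermT_eq_stepOut]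
  exact stepOutT_gaugeAct_on F N T χ ε g hk hTon hDst hAon v hWD hnest hW hu

/-- **THE DIFFERENCE FUNCTIONAL ON THE DOMAIN**: `𝓓_{k+1}(W^v) = 𝓓_{k+1}(W)` for `W ∈ D'` (the two previous rows; both image clauses displayed).
[cite: Balaban1987RG1, (1.19) p.263, (2.16) p.269] -/
theorem dChannel_gaugeAct_on (T : Transport F N) (χ : (K : ℕ) → (ℕ → ℝ) → (k : ℕ) → Density (F.P K) k (SU N)) (ε : ℝ) {K : ℕ}
    (g : ℕ → ℝ) {k : ℕ} (hk : k + 1 ≤ (F.P K).m + (F.P K).K) {D : Set (GaugeField (F.P K) k (SU N))}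
    {D' : Set (GaugeField (F.P K) (k + 1) (SU N))}
    (hTon : ∀ (v : GaugeTransf (F.P K) (k + 1) (SU N)) (V : GaugeField (F.P K) (k + 1) (SU N)), V ∈ D' →
      T K k (integrand (χ K g k) (gfOfRecord F N K k) (g k) (effActionHT F N T χ K g k)) (gaugeAct v V) =
        T K k (integrand (χ K g k) (gfOfRecord F N K k) (g k) (effActionHT F N T χ K g k)) V)
    (hTon₀ : ∀ (v : GaugeTransf (F.P K) (k + 1) (SU N)) (V : GaugeField (F.P K) (k + 1) (SU N)), V ∈ D' →
      T K k (integrand (χ K g k) (gfOfRecord F N K k) (g k) (mainTermT F N ε K g k)) (gaugeAct v V) =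
        T K k (integrand (χ K g k) (gfOfRecord F N K k) (g k) (mainTermT F N ε K g k)) V)
    (hDst : ∀ (w : GaugeTransf (F.P K) k (SU N)) (U : GaugeField (F.P K) k (SU N)), U ∈ D → gaugeAct w U ∈ D)
    (hAon : ∀ (w : GaugeTransf (F.P K) k (SU N)) (U : GaugeField (F.P K) k (SU N)), U ∈ D →
      effActionHT F N T χ K g k (gaugeAct w U) = effActionHT F N T χ K g k U)
    (v : GaugeTransf (F.P K) (k + 1) (SU N)) {W : GaugeField (F.P K) (k + 1) (SU N)} (hWD : W ∈ D')
    (hnest : Averaging.iter (avOfRecord F N K) k (Uk F N K (k + 1) ε W) ∈ D)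
    (hW : UkExists F N K (k + 1) ε W) (hu : UniqueUkOrbit F N K (k + 1) ε (gaugeAct v W)) :
    mergedTermT F N T χ ε K g k (gaugeAct v W) - zeroInputMergedTermT F N T χ ε K g k (gaugeAct v W) =
      mergedTermT F N T χ ε K g k W - zeroInputMergedTermT F N T χ ε K g k W := by
  rw [mergedTermT_gaugeAct_on F N T χ ε g hk hTon hDst hAon v hWD hnest hW hu,
    zeroInputMergedTermT_gaugeAct_on F N T χ ε g hk hTon₀ v hWD hW hu]

end Summit.QuantumFields.YangMills.Theorems.PortZD

end
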